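import Summits.QuantumFields.YangMills.Theorems.ColdStartUniversalityLatticeLangevinWilsonGeneratorPoincare
import HarnessLib

/-!
# Route `ColdStartUniversality` (fixed-cut-off `L²` package): the EXPLICIT spectral gap `3/2` of the `β' = 0` dynamics, I —
# eigen-expansion of ridge form: `∫ (κ⁰_t F − ∫F)² dHaar^{⊗E} ≤ e^{−3t} Var_{Haar}(F)` for every ridge-form `F`

Helper file (seat `ym-line-csu-p1`, g19; `--supports stmt-QuantumFields-27363`).  At coupling `β' = 0` the SU(2) lattice Langevin
dynamics of Shen–Zhu–Zhu on `(ℤ/L)³` is Brownian motion on `SU(2)^E` (Hilbert–Schmidt metric) and its invariant Wilson measure is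
product Haar (`wilsonMeasure_zero_eq_pi`).  The tree already knows that any realising kernel family `κ⁰` acts DIAGONALLY on ridge
form (`integral_ridge_transitionKernel_beta_zero`: a product `R_m` of latitude eigenfunctions with degree vector `m = (m_e)` is an
eigenfunction with eigenvalue `e^{−λ_m t}`, `λ_m = Σ_e m_e(m_e+2)/2` — the spectrum of the Laplacian on `S³(√2)^E`) and that products with
different degree vectors are Haar-orthogonal (`integral_prod_gegenbauer_mul_prod_gegenbauer_pi_haar_eq_zero`).  Since `λ_m ≥ 3/2` for
`m ≠ 0`, Pythagoras along the fibres of the degree map gives the decay with the explicit rate `3/2`: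

* `integral_sq_sum_eq_of_orthogonal` — Pythagoras for a finite orthogonal family;
* `integral_sq_sub_le_of_eigen_expansion` — the abstract eigen-expansion bound (any compact space, any kernel acting diagonally);
* `three_halves_le_latitudeEigenvalue` — `λ_m ≥ 3/2` for `m ≠ 0`;
* ★ `integral_sq_transition_sub_le_exp_beta_zero_ridge` — `∫ (κ⁰_t F − μ₀F)² dμ₀ ≤ e^{−2·(3/2)·t} Var_{μ₀}(F)` for every ridge-form `F`,
  every realising kernel family, every `t` (`μ₀ = wilsonMeasure 0 = Haar^{⊗E}`).

The sequel `…HaarSpectralGap` passes to all continuous observables (uniform density of ridge form), shows the rate is attained, and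
derives the generator-form Poincaré inequality with constant `3/2` for product Haar measure.  THEOREMS ONLY, no definition, no sorry.
HONEST FRAMING: RECORD-rung R3 plumbing at FIXED cut-off (here at `β' = 0`, no Yang–Mills content); nothing K-uniform is proved; no crux,
rung or summit statement is proved; the Yang–Mills mass gap is NOT proved.
-/

set_option autoImplicit false

noncomputable section

namespace Summit.QuantumFields.YangMills.Theorems.ColdStartUniversality

open MeasureTheory ProbabilityTheory Finset Filter Set Topology
open scoped BigOperators NNReal ENNReal
open Literature.Probability.Process Literature.MathematicalPhysics.QuantumFieldTheory
open Literature.MathematicalPhysics.QuantumLattice (fundamentalRep fundamentalLatticeRep continuous_fundamentalRep)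
open Literature.Analysis.SpecialFunctions (gegenbauerSum gegenbauerSum_zero gegenbauerSum_one)

variable {L : ℕ} [NeZero L]


/-! ## Abstract steps: Pythagoras for an orthogonal family, and the eigen-expansion bound -/

/-- **Pythagoras for a finite orthogonal family**: `∫ (Σ_{n∈D} w_n Φ_n)² dν = Σ_{n∈D} w_n² ∫ Φ_n² dν` when `∫ Φ_n Φ_{n'} dν = 0` for
`n ≠ n'` in `D` (all products integrable). [folklore] -/
theorem integral_sq_sum_eq_of_orthogonal {X δ : Type*} [MeasurableSpace X] (ν : Measure X) (D : Finset δ)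
    (Φ : δ → X → ℝ) (w : δ → ℝ) (hint : ∀ n ∈ D, ∀ n' ∈ D, Integrable (fun x => Φ n x * Φ n' x) ν)
    (horth : ∀ n ∈ D, ∀ n' ∈ D, n ≠ n' → ∫ x, Φ n x * Φ n' x ∂ν = 0) :
    ∫ x, (∑ n ∈ D, w n * Φ n x) ^ 2 ∂ν = ∑ n ∈ D, w n ^ 2 * ∫ x, (Φ n x) ^ 2 ∂ν := by
  classical
  have hexp : ∀ x, (∑ n ∈ D, w n * Φ n x) ^ 2 = ∑ n ∈ D, ∑ n' ∈ D, (w n * w n') * (Φ n x * Φ n' x) := by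
    intro x
    rw [sq, Finset.sum_mul_sum]
    exact Finset.sum_congr rfl fun n _ => Finset.sum_congr rfl fun n' _ => by ring
  simp_rw [hexp]
  rw [integral_finsetSum _ fun n hn => integrable_finsetSum _ fun n' hn' => (hint n hn n' hn').const_mul _]
  refine Finset.sum_congr rfl fun n hn => ?_
  rw [integral_finsetSum _ fun n' hn' => (hint n hn n' hn').const_mul _]
  rw [Finset.sum_eq_single_of_mem n hn fun n' hn' hne => by
    rw [integral_const_mul, horth n hn n' hn' (Ne.symm hne), mul_zero]]
  rw [integral_const_mul]
  simp only [sq]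

/-- **Eigen-expansion bound** (abstract form of the `β' = 0` spectral gap).  On a compact space with a probability measure `ν`, let
`R_l` (`l ∈ ι`) be continuous functions labelled by degrees `m_l ∈ δ`, orthogonal across different degrees, with `R_l ≡ 1` and
`∫ R_l dν = 1` in degree `d₀` and `∫ R_l dν = 0` otherwise; let a kernel `κ` act diagonally, `κ(Σ c_l R_l) = Σ c_l a(m_l) R_l` with
`a(d₀) = 1` and `a(d)² ≤ r` for `d ≠ d₀`.  Then `∫ (κF − ∫F)² dν ≤ r ∫ (F − ∫F)² dν` for `F = Σ_l c_l R_l` (group the sum along the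
fibres of `m` and apply Pythagoras on both sides). [folklore] -/
theorem integral_sq_sub_le_of_eigen_expansion {X ι δ : Type*} [MeasurableSpace X] [TopologicalSpace X] [CompactSpace X]
    [OpensMeasurableSpace X] [Fintype ι] [DecidableEq δ] (ν : Measure X) [IsProbabilityMeasure ν] (κ : X → Measure X)
    (R : ι → X → ℝ) (hR : ∀ l, Continuous (R l)) (c : ι → ℝ) (m : ι → δ) (d₀ : δ) (a : δ → ℝ) {r : ℝ}
    (hκ : ∀ x, ∫ y, (∑ l, c l * R l y) ∂(κ x) = ∑ l, c l * a (m l) * R l x)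
    (hmean : ∀ l, ∫ z, R l z ∂ν = if m l = d₀ then 1 else 0) (hR0 : ∀ l, m l = d₀ → ∀ x, R l x = 1) (ha0 : a d₀ = 1)
    (horth : ∀ l l', m l ≠ m l' → ∫ x, R l x * R l' x ∂ν = 0) (ha : ∀ d, d ≠ d₀ → a d ^ 2 ≤ r) :
    ∫ x, ((∫ y, (∑ l, c l * R l y) ∂(κ x)) - ∫ z, (∑ l, c l * R l z) ∂ν) ^ 2 ∂ν ≤
      r * ∫ x, ((∑ l, c l * R l x) - ∫ z, (∑ l, c l * R l z) ∂ν) ^ 2 ∂ν := by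
  classical
  -- the mean of `F`
  have hRint : ∀ l, Integrable (R l) ν := fun l => integrable_of_continuous_of_compactSpace (hR l) ν
  have hmeanF : ∫ z, (∑ l, c l * R l z) ∂ν = ∑ l, c l * (if m l = d₀ then 1 else 0) := by
    rw [integral_finsetSum _ fun l _ => (hRint l).const_mul (c l)]
    refine Finset.sum_congr rfl fun l _ => ?_
    rw [integral_const_mul, hmean l]
  -- the two centred functions as weighted sums (degree `d₀` drops out)
  have hdiffκ : ∀ x, (∫ y, (∑ l, c l * R l y) ∂(κ x)) - ∫ z, (∑ l, c l * R l z) ∂ν =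
      ∑ l, (if m l = d₀ then 0 else a (m l)) * (c l * R l x) := by
    intro x
    rw [hκ x, hmeanF, ← Finset.sum_sub_distrib]
    refine Finset.sum_congr rfl fun l _ => ?_
    by_cases hl : m l = d₀
    · rw [if_pos hl, if_pos hl, hR0 l hl x, hl, ha0]; ring
    · rw [if_neg hl, if_neg hl]; ring
  have hdiff0 : ∀ x, (∑ l, c l * R l x) - ∫ z, (∑ l, c l * R l z) ∂ν =
      ∑ l, (if m l = d₀ then 0 else (1 : ℝ)) * (c l * R l x) := by
    intro x
    rw [hmeanF, ← Finset.sum_sub_distrib]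
    refine Finset.sum_congr rfl fun l _ => ?_
    by_cases hl : m l = d₀
    · rw [if_pos hl, if_pos hl, hR0 l hl x]; ring
    · rw [if_neg hl, if_neg hl]; ring
  -- regrouping along the fibres of the degree map
  set D : Finset δ := Finset.univ.image m with hD
  have hregroup : ∀ (w : δ → ℝ) (x : X), ∑ l, w (m l) * (c l * R l x) =
      ∑ n ∈ D, w n * ∑ l ∈ Finset.univ.filter (fun l => m l = n), c l * R l x := by
    intro w x
    have h := Finset.sum_fiberwise_of_maps_to (s := Finset.univ) (t := D) (g := m)
      (fun l hl => Finset.mem_image_of_mem m hl) (fun l => w (m l) * (c l * R l x))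
    rw [← h]
    refine Finset.sum_congr rfl fun n _ => ?_
    rw [Finset.mul_sum]
    refine Finset.sum_congr rfl fun l hl => ?_
    rw [(Finset.mem_filter.1 hl).2]
  have hregroupκ : ∀ x, ∑ l, (if m l = d₀ then 0 else a (m l)) * (c l * R l x) =
      ∑ n ∈ D, (if n = d₀ then 0 else a n) * ∑ l ∈ Finset.univ.filter (fun l => m l = n), c l * R l x := fun x => by
    have h := hregroup (fun d => if d = d₀ then 0 else a d) x
    beta_reduce at h
    exact h
  have hregroup0 : ∀ x, ∑ l, (if m l = d₀ then 0 else (1 : ℝ)) * (c l * R l x) =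
      ∑ n ∈ D, (if n = d₀ then 0 else (1 : ℝ)) * ∑ l ∈ Finset.univ.filter (fun l => m l = n), c l * R l x := fun x => by
    have h := hregroup (fun d => if d = d₀ then 0 else (1 : ℝ)) x
    beta_reduce at h
    exact h
  -- orthogonality and integrability of the fibre sums
  have hΦcont : ∀ n, Continuous fun x => ∑ l ∈ Finset.univ.filter (fun l => m l = n), c l * R l x := fun n =>
    continuous_finsetSum _ fun l _ => continuous_const.mul (hR l)
  have hint : ∀ n ∈ D, ∀ n' ∈ D, Integrable (fun x => (∑ l ∈ Finset.univ.filter (fun l => m l = n), c l * R l x) *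
      (∑ l ∈ Finset.univ.filter (fun l => m l = n'), c l * R l x)) ν := fun n _ n' _ =>
    integrable_of_continuous_of_compactSpace ((hΦcont n).mul (hΦcont n')) ν
  have horthΦ : ∀ n ∈ D, ∀ n' ∈ D, n ≠ n' → ∫ x, (∑ l ∈ Finset.univ.filter (fun l => m l = n), c l * R l x) *
      (∑ l ∈ Finset.univ.filter (fun l => m l = n'), c l * R l x) ∂ν = 0 := by
    intro n _ n' _ hnn'
    have hRRint : ∀ l l', Integrable (fun x => c l * R l x * (c l' * R l' x)) ν := fun l l' =>
      integrable_of_continuous_of_compactSpace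
        ((continuous_const.mul (hR l)).mul (continuous_const.mul (hR l')) :
          Continuous fun x => c l * R l x * (c l' * R l' x)) ν
    simp_rw [Finset.sum_mul_sum]
    rw [integral_finsetSum _ fun l _ => integrable_finsetSum _ fun l' _ => hRRint l l']
    refine Finset.sum_eq_zero fun l hl => ?_
    rw [integral_finsetSum _ fun l' _ => hRRint l l']
    refine Finset.sum_eq_zero fun l' hl' => ?_
    have hne : m l ≠ m l' := by
      rw [(Finset.mem_filter.1 hl).2, (Finset.mem_filter.1 hl').2]; exact hnn'
    have e : ∀ x, c l * R l x * (c l' * R l' x) = (c l * c l') * (R l x * R l' x) := fun x => by ring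
    simp_rw [e]
    rw [integral_const_mul, horth l l' hne, mul_zero]
  -- Pythagoras on both sides and comparison fibre by fibre
  simp_rw [hdiffκ, hdiff0, hregroupκ, hregroup0]
  rw [integral_sq_sum_eq_of_orthogonal ν D _ _ hint horthΦ, integral_sq_sum_eq_of_orthogonal ν D _ _ hint horthΦ, Finset.mul_sum]
  refine Finset.sum_le_sum fun n hn => ?_
  have hI : 0 ≤ ∫ x, (∑ l ∈ Finset.univ.filter (fun l => m l = n), c l * R l x) ^ 2 ∂ν :=
    integral_nonneg fun x => sq_nonneg _
  by_cases hn0 : n = d₀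
  · rw [if_pos hn0, if_pos hn0]; simp
  · rw [if_neg hn0, if_neg hn0, one_pow, one_mul]
    exact mul_le_mul_of_nonneg_right (ha n hn0) hI

/-- The eigenvalue `λ_m = Σ_e m_e(m_e+2)/2` of a product of latitude eigenfunctions with degree vector `m ≠ 0` is at least `3/2`
(one factor has degree `≥ 1`): the spectral gap of Brownian motion on `SU(2)^E ≅ S³(√2)^E`. [folklore] -/
theorem three_halves_le_latitudeEigenvalue {m : Edge 3 L → ℕ} (hm : m ≠ 0) :
    (3 : ℝ) / 2 ≤ ∑ e, (m e : ℝ) * ((m e : ℝ) + 2) / 2 := by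
  obtain ⟨e, he⟩ := Function.ne_iff.1 hm
  have h1 : (1 : ℝ) ≤ m e := by exact_mod_cast Nat.one_le_iff_ne_zero.2 he
  calc (3 : ℝ) / 2 ≤ (m e : ℝ) * ((m e : ℝ) + 2) / 2 := by nlinarith
    _ ≤ ∑ e', (m e' : ℝ) * ((m e' : ℝ) + 2) / 2 :=
        Finset.single_le_sum (f := fun e' => (m e' : ℝ) * ((m e' : ℝ) + 2) / 2)
          (fun e' _ => by positivity) (Finset.mem_univ e)

/-! ## The ridge class: `L²(Haar^{⊗E})` decay at rate `3/2` -/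

/-- ★ **`L²` decay at rate `3/2` on ridge form at `β' = 0`.**  For ANY Markov kernel family `κ⁰` realising the transition laws of the
`β' = 0` SZZ dynamics, every ridge-form `F = Σ_l c_l ∏_e U_{m_{l,e}}(⟨ρ g_{l,e}, ρ V_e⟩/2)` and every lattice time `t`,
`∫ (κ⁰_t F − μ₀F)² dμ₀ ≤ e^{−2·(3/2)·t} ∫ (F − μ₀F)² dμ₀`, `μ₀ = wilsonMeasure 0 = Haar^{⊗E}`.  Eigen-expansion
(`integral_ridge_transitionKernel_beta_zero`), Haar orthogonality across degree vectors, `λ_m ≥ 3/2` for `m ≠ 0`. [folklore] -/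
theorem integral_sq_transition_sub_le_exp_beta_zero_ridge
    (κ₀ : ℝ≥0 → Kernel (GaugeConfig 3 L (Matrix.specialUnitaryGroup (Fin 2) ℂ))
      (GaugeConfig 3 L (Matrix.specialUnitaryGroup (Fin 2) ℂ))) [∀ t, IsMarkovKernel (κ₀ t)]
    (hreal₀ : ∀ (t : ℝ≥0) (x : GaugeConfig 3 L (Matrix.specialUnitaryGroup (Fin 2) ℂ))
        (Ω : Type) [MeasurableSpace Ω] (P : Measure Ω) [IsProbabilityMeasure P]
        (W : ℝ≥0 → Ω → (Edge 3 L × NoiseIdx 2 → ℝ)) (hW : IsFlatBrownian W P)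
        (U : ℝ≥0 → Ω → GaugeConfig 3 L (Matrix.specialUnitaryGroup (Fin 2) ℂ)),
        (∀ ω, U 0 ω = x) →
        (latticeLangevinDynamics (fundamentalLatticeRep 2) 0).IsSolution (fundamentalRep (Fin 2))
          hW.natFiltration P W U →
        κ₀ t x = P.map (U t))
    {ι : Type} [Fintype ι] (c : ι → ℝ) (g : ι → Edge 3 L → Matrix.specialUnitaryGroup (Fin 2) ℂ) (m : ι → Edge 3 L → ℕ)
    (t : ℝ≥0) :
    ∫ x, ((∫ y, (∑ l, c l * ∏ e, gegenbauerSum 1 (m l e)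
        (hsForm 2 (fundamentalRep (Fin 2) (g l e)) (fundamentalRep (Fin 2) (y e)) / 2)) ∂(κ₀ t x)) -
        ∫ z, (∑ l, c l * ∏ e, gegenbauerSum 1 (m l e)
          (hsForm 2 (fundamentalRep (Fin 2) (g l e)) (fundamentalRep (Fin 2) (z e)) / 2))
          ∂(wilsonMeasure (d := 3) (L := L) (fundamentalRep (Fin 2)) 0)) ^ 2
        ∂(wilsonMeasure (d := 3) (L := L) (fundamentalRep (Fin 2)) 0) ≤
      Real.exp (-2 * (3 / 2) * t) *
        ∫ x, ((∑ l, c l * ∏ e, gegenbauerSum 1 (m l e)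
          (hsForm 2 (fundamentalRep (Fin 2) (g l e)) (fundamentalRep (Fin 2) (x e)) / 2)) -
          ∫ z, (∑ l, c l * ∏ e, gegenbauerSum 1 (m l e)
            (hsForm 2 (fundamentalRep (Fin 2) (g l e)) (fundamentalRep (Fin 2) (z e)) / 2))
            ∂(wilsonMeasure (d := 3) (L := L) (fundamentalRep (Fin 2)) 0)) ^ 2
          ∂(wilsonMeasure (d := 3) (L := L) (fundamentalRep (Fin 2)) 0) := by
  classical
  haveI := secondCountableTopology_su2
  haveI := borelSpace_config L
  haveI : IsProbabilityMeasure (haarProbability (Matrix.specialUnitaryGroup (Fin 2) ℂ)) := inferInstance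
  rw [wilsonMeasure_zero_eq_pi]
  refine integral_sq_sub_le_of_eigen_expansion
    (Measure.pi fun _ : Edge 3 L => haarProbability (Matrix.specialUnitaryGroup (Fin 2) ℂ)) (fun x => (κ₀ t x : Measure _))
    (fun l y => ∏ e, gegenbauerSum 1 (m l e) (hsForm 2 (fundamentalRep (Fin 2) (g l e)) (fundamentalRep (Fin 2) (y e)) / 2))
    (fun l => continuous_prod_gegenbauer_latitude (L := L) (g l) (m l)) c m 0
    (fun n => Real.exp (-(∑ e, (n e : ℝ) * ((n e : ℝ) + 2) / 2) * t)) ?_ ?_ ?_ ?_ ?_ ?_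
  · -- diagonal action of `κ⁰_t`
    intro x
    exact integral_ridge_transitionKernel_beta_zero κ₀ hreal₀ c g m t x
  · -- Haar means
    intro l
    exact integral_prod_gegenbauer_latitude_pi_haar (g l) (m l)
  · -- degree zero is the constant `1`
    intro l hl y
    simp [hl]
  · -- eigenvalue `1` in degree zero
    simp
  · -- orthogonality across degree vectors
    intro l l' hne
    exact integral_prod_gegenbauer_mul_prod_gegenbauer_pi_haar_eq_zero (g l) (g l') hne
  · -- `e^{−2 λ_m t} ≤ e^{−3t}` for `m ≠ 0`
    intro n hn
    rw [← Real.exp_nat_mul, Real.exp_le_exp]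
    have h := three_halves_le_latitudeEigenvalue (L := L) hn
    have ht : (0 : ℝ) ≤ t := t.2
    push_cast
    nlinarith

end Summit.QuantumFields.YangMills.Theorems.ColdStartUniversality

end
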